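import Literature.Geometry.Lorentzian.CommonDevelopmentRigidity
import HarnessLib

/-!
# The maximal common globally hyperbolic development of two developments
# (Sbierski 2016, Def. 2.4 and Thm. 10 "Existence of the MCGHD")

J. Sbierski, *On the existence of a maximal Cauchy development for the Einstein equations: a
dezornification*, Ann. Henri Poincaré 17 (2016) 301–329 = arXiv:1309.7591v3.

**Definition 2.4** (arXiv numbering): *"Given two GHDs `M` and `M'` of the same initial data, we
say that a GHD `(U ⊆ M, g|_U, ι)` is a common globally hyperbolic development (CGHD) of `M` and
`M'` iff `M'` is an extension of `(U, g|_U, ι)`"* — an extension being a time-orientation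
preserving isometric embedding `ψ : U → M'` with `ψ ∘ ι = ι'` (Def. 2.3), where *"one does not
need to require `ψ` to be an isometric embedding — `ψ` being an isometric immersion suffices"*
(remark after Lemma 9). This is `CauchyDevelopment.IsCommonDevelopment 𝒟 𝒮' U`: `U ⊆ M` is an
open subset of the spacetime of the Cauchy development `𝒟` containing the data hypersurface
`ι(X)`, `ι(X)` is a Cauchy hypersurface of the open sub-spacetime `(U, g|_U, τ|_U)`
(`LorentzianMetric.restrict`, `TimeOrientation.restrict` with the discharged restriction facts),
and there is a time-orientation preserving isometric immersion `ψ : U → M'` of the open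
sub-spacetime into the spacetime of the data embedding `𝒮'` with `ψ ∘ ι = ι'`. For a globally
hyperbolic target such a `ψ` is automatically an embedding of developments (Lemma 9,
`CauchyDevelopment.embedsInto_of_isIsometricImmersion`): `IsCommonDevelopment.restrict_embedsInto`
recovers Def. 2.4 verbatim over `CauchyDevelopment.restrict` (`CauchyDevelopmentRestrict`), and
`isCommonDevelopment_of_restrict_embedsInto` is the converse.

**Theorem 10 (Existence of MCGHD).** *"Given two GHDs `M` and `M'` of the same initial data,
there exists a unique CGHD `U` of `M` and `M'` with the property that if `V` is another CGHD of
`M` and `M'`, then `U` is an extension of `V`. … The much simpler method of taking the union of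
all CGHDs of `M` and `M'` however works."* Here: `CauchyDevelopment.mcghd 𝒟 𝒮'` is the union
(supremum in `Opens M`) of all `U` with `IsCommonDevelopment 𝒟 𝒮' U`;
`CauchyDevelopment.isCommonDevelopment_mcghd` proves it is itself a common development **provided
one exists** (the printed *"By Theorem 4 this set is non-empty"* — local existence and
uniqueness for the Einstein equations, Choquet-Bruhat 1952 — is displayed as the hypothesis
`hne`); `le_mcghd` is its maximality, `exists_isCommonDevelopment_maximal` and
`IsCommonDevelopment.eq_mcghd_of_maximal` are the existence and uniqueness clauses of Thm. 10.

Proof of `isCommonDevelopment_mcghd`, bullet by bullet as printed (p. 12 of the arXiv version):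
* *"`U` is globally hyperbolic with Cauchy surface `ι(M̄)`"* —
  `LorentzianMetric.IsCauchyHypersurface.iSup_opens` (`OpensCausality`);
* *"For each `α` there is such an isometric immersion `ψ_α : U_α → M'`. We define
  `ψ(p) := ψ_α(p)` for `p ∈ U_α`. By Corollary 8 this is well-defined"* — `mcghdFun` (the glued
  map on `M`, by choice, junk outside the union) and `mcghdFun_eq` (it agrees on every CGHD `U`
  with **every** admissible immersion of `U`, by `CauchyDevelopment.eq_of_isIsometricImmersion_opens`
  = Cor. 8, `CommonDevelopmentRigidity`);
* *"clearly `ψ` is an isometric immersion that respects the embedding of `M̄` and the time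
  orientation"* — smoothness, the isometry identity and time-orientation preservation are local
  and are read off on the CGHD through the point (`contMDiffAt_mcghdFun`, `mfderiv_mcghdFun_eq`,
  Mathlib's `contMDiffAt_subtype_iff` and `mfderiv_comp_subtypeVal`);
* *"That `U` is maximal follows directly from its definition"* — `le_mcghd` (`le_iSup`).

Also: if `𝒟` itself embeds into `𝒮'` then the whole spacetime is a common development and the
MCGHD is everything (`isCommonDevelopment_top_of_embedsInto`, `mcghd_eq_top_of_embedsInto`).

No named facts are introduced (D-0026); the definitions `IsCommonDevelopment`, `mcghd`,
`mcghdFun`, `mcghdMap` have bodies, everything else is proved.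

## References

* J. Sbierski, Ann. Henri Poincaré 17 (2016) 301–329 = arXiv:1309.7591v3, §2, Def. 2.3–2.4,
  remark after Lemma 9; §3.1, Cor. 8, Lemma 9, Thm. 10 and its proof (p. 12).
* Y. Choquet-Bruhat, R. Geroch, *Global aspects of the Cauchy problem in general relativity*,
  Comm. Math. Phys. 14 (1969) 329–335, proof of Thm. 3, p. 332 ("the collection of all pairs
  (U, ψ) … partially ordered by inclusion").
* H. Ringström, *The Cauchy Problem in General Relativity*, EMS 2009, Ch. 23 (the maximal common
  development via Zorn's lemma).
-/

noncomputable section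

open Bundle Set Function Filter TopologicalSpace Topology Manifold
open scoped Manifold ContDiff Topology

namespace Literature.Geometry.Lorentzian

universe u

section PointCongr

variable {E : Type*} [NormedAddCommGroup E] [NormedSpace ℝ E] {H : Type*} [TopologicalSpace H]
  {I : ModelWithCorners ℝ E H} {m : ℕ∞ω} {M : Type*} [TopologicalSpace M] [ChartedSpace H M]
  [IsManifold I ∞ M] {g : LorentzianMetric I m M}

/-- Future-directedness of a vector of the model fibre does not depend on the name of the base
point (transport along an equality of points; `T_x M = E` definitionally). [folklore] -/
theorem TimeOrientation.isFutureDirected_congr_point (τ : TimeOrientation g) {x y : M}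
    (h : x = y) {v : E} :
    τ.IsFutureDirected (x := x) v ↔ τ.IsFutureDirected (x := y) v := by
  subst h
  exact Iff.rfl

end PointCongr

section Developments

variable {n : ℕ} {X : Type u} [TopologicalSpace X] [ChartedSpace (EuclideanSpace ℝ (Fin n)) X]
  [IsManifold (𝓡 n) ∞ X] [ConnectedSpace X] {D : InitialDataSet (𝓡 n) X}

/-! ### The range of the codomain-restricted data embedding -/

namespace DataEmbedding

/-- The image of the codomain-restricted data embedding `ι : X → U` is the trace on `U` of the
data hypersurface `ι(X)`. [folklore] -/
theorem range_embedOpens (𝒮 : DataEmbedding D) (U : Opens 𝒮.carrier) (hι : ∀ x, 𝒮.embed x ∈ U) :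
    range (𝒮.embedOpens U hι) = Subtype.val ⁻¹' range 𝒮.embed := by
  ext y
  constructor
  · rintro ⟨x, rfl⟩
    exact ⟨x, rfl⟩
  · rintro ⟨x, hx⟩
    exact ⟨x, Subtype.ext hx⟩

end DataEmbedding

namespace CauchyDevelopment

variable (𝒟 : CauchyDevelopment D) (𝒮' : DataEmbedding D)

/-! ### Common globally hyperbolic developments as open subsets (Sbierski 2016, Def. 2.4) -/

/-- **Common globally hyperbolic development, realised as an open subset** (Sbierski 2016,
Def. 2.4, with the remark after Lemma 9). The open subset `U ⊆ M` of the spacetime of the Cauchy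
development `𝒟 = (M, g, τ, ι, ν)` of `D` is a *common (globally hyperbolic) development of `𝒟`
and the data embedding `𝒮' = (M', g', τ', ι', ν')`* if: `ι(X) ⊆ U`; `ι(X)` is a Cauchy
hypersurface of the open sub-spacetime `(U, g|_U, τ|_U)` (so that `(U, g|_U, ι)` is a globally
hyperbolic development of `D`, `CauchyDevelopment.restrict`); and there is a time-orientation
preserving isometric immersion `ψ : (U, g|_U, τ|_U) → (M', g', τ')` with `ψ ∘ ι = ι'` (*"`M'` is
an extension of `(U, g|_U, ι)`"*; for a globally hyperbolic `M'` such a `ψ` is an isometric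
embedding by Lemma 9, `IsCommonDevelopment.restrict_embedsInto`).
[cite: Sbierski2016AHP, §2, Def. 2.4 (arXiv: Def. 4) and remark after Lemma 9] -/
structure IsCommonDevelopment (U : Opens 𝒟.carrier) : Prop where
  /-- The data hypersurface lies in `U`: `ι(X) ⊆ U`. -/
  embed_mem : ∀ x, 𝒟.embed x ∈ U
  /-- `ι(X)` is a Cauchy hypersurface of the open sub-spacetime `(U, g|_U, τ|_U)`. -/
  isCauchyHypersurface :
    (𝒟.metric.restrict PseudoRiemannianMetric.contMDiff_restrict_holds U).IsCauchyHypersurface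
      (𝒟.timeOrientation.restrict PseudoRiemannianMetric.contMDiff_restrict_holds
        𝒟.timeOrientation.contMDiff_restrict_holds U) (Subtype.val ⁻¹' range 𝒟.embed)
  /-- `M'` extends `(U, g|_U, ι)`: a time-orientation preserving isometric immersion
  `ψ : U → M'` with `ψ ∘ ι = ι'`. -/
  exists_isIsometricImmersion : ∃ ψ : U → 𝒮'.carrier,
    (𝒟.metric.restrict PseudoRiemannianMetric.contMDiff_restrict_holds U).IsIsometricImmersion
        𝒮'.metric.toPseudoRiemannianMetric ψ ∧
      (𝒟.timeOrientation.restrict PseudoRiemannianMetric.contMDiff_restrict_holds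
        𝒟.timeOrientation.contMDiff_restrict_holds U).PreservesTimeOrientation ψ
          𝒮'.timeOrientation ∧
      ψ ∘ 𝒟.embedOpens U embed_mem = 𝒮'.embed

variable {𝒟 𝒮'}

namespace IsCommonDevelopment

/-- A common development is connected (`CauchyDevelopment.isConnected_inter_opens` with
`U₁ = U₂ = U`: every point is joined to the connected data hypersurface by a segment of the
integral curve of the orienting field). Sbierski 2016, Def. 2.2 (GHDs are connected).
[cite: Sbierski2016AHP, §2, Def. 2.2 and Def. 2.4] -/
theorem isConnected {U : Opens 𝒟.carrier} (h : 𝒟.IsCommonDevelopment 𝒮' U) :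
    IsConnected (U : Set 𝒟.carrier) := by
  simpa only [inter_self] using
    𝒟.isConnected_inter_opens h.embed_mem h.embed_mem h.isCauchyHypersurface h.isCauchyHypersurface

/-- **Corollary 8 for common developments**: any two admissible immersions of any two common
developments agree on the intersection (`CauchyDevelopment.eq_of_isIsometricImmersion_opens`).
[cite: Sbierski2016AHP, §3.1, Cor. 8 (arXiv numbering)] -/
theorem apply_eq_apply {U₁ U₂ : Opens 𝒟.carrier} (h₁ : 𝒟.IsCommonDevelopment 𝒮' U₁)
    (h₂ : 𝒟.IsCommonDevelopment 𝒮' U₂) {ψ₁ : U₁ → 𝒮'.carrier} {ψ₂ : U₂ → 𝒮'.carrier}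
    (hψ₁i : (𝒟.metric.restrict PseudoRiemannianMetric.contMDiff_restrict_holds U₁).IsIsometricImmersion
      𝒮'.metric.toPseudoRiemannianMetric ψ₁)
    (hψ₁τ : (𝒟.timeOrientation.restrict PseudoRiemannianMetric.contMDiff_restrict_holds
      𝒟.timeOrientation.contMDiff_restrict_holds U₁).PreservesTimeOrientation ψ₁ 𝒮'.timeOrientation)
    (hψ₁ι : ψ₁ ∘ 𝒟.embedOpens U₁ h₁.embed_mem = 𝒮'.embed)
    (hψ₂i : (𝒟.metric.restrict PseudoRiemannianMetric.contMDiff_restrict_holds U₂).IsIsometricImmersion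
      𝒮'.metric.toPseudoRiemannianMetric ψ₂)
    (hψ₂τ : (𝒟.timeOrientation.restrict PseudoRiemannianMetric.contMDiff_restrict_holds
      𝒟.timeOrientation.contMDiff_restrict_holds U₂).PreservesTimeOrientation ψ₂ 𝒮'.timeOrientation)
    (hψ₂ι : ψ₂ ∘ 𝒟.embedOpens U₂ h₂.embed_mem = 𝒮'.embed)
    {p : 𝒟.carrier} (hp₁ : p ∈ U₁) (hp₂ : p ∈ U₂) : ψ₁ ⟨p, hp₁⟩ = ψ₂ ⟨p, hp₂⟩ :=
  𝒟.eq_of_isIsometricImmersion_opens 𝒮' h₁.embed_mem h₂.embed_mem h₁.isCauchyHypersurface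
    h₂.isCauchyHypersurface hψ₁i hψ₁τ hψ₁ι hψ₂i hψ₂τ hψ₂ι hp₁ hp₂

end IsCommonDevelopment

/-! ### Relation with `CauchyDevelopment.restrict` (Def. 2.4 verbatim) -/

/-- **Def. 2.4 verbatim, forward**: a common development `U ⊆ M` of `𝒟` and a *globally
hyperbolic* development `𝒟'`, viewed as a Cauchy development `(U, g|_U, τ|_U, ι, ν)`
(`CauchyDevelopment.restrict`; the normal `ν` of `𝒟` differentiable along `ι`), embeds into
`𝒟'`: its isometric immersion is injective and open by Lemma 9
(`CauchyDevelopment.embedsInto_of_isIsometricImmersion`). [cite: Sbierski2016AHP, §2, Def. 2.4 with §3.1, Lemma 9 (arXiv numbering)] -/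
theorem IsCommonDevelopment.restrict_embedsInto {𝒟' : CauchyDevelopment D} {U : Opens 𝒟.carrier}
    (h : 𝒟.IsCommonDevelopment 𝒟'.toDataEmbedding U) (hU : IsConnected (U : Set 𝒟.carrier))
    (hν : ∀ x, MDifferentiableAt (𝓡 n) (𝓡 (n + 1)).tangent
      (fun x ↦ (TotalSpace.mk' (EuclideanSpace ℝ (Fin (n + 1))) (𝒟.embed x) (𝒟.normal x) :
        TangentBundle (𝓡 (n + 1)) 𝒟.carrier)) x)
    (hC : (𝒟.metric.restrict PseudoRiemannianMetric.contMDiff_restrict_holds U).IsCauchyHypersurface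
      (𝒟.timeOrientation.restrict PseudoRiemannianMetric.contMDiff_restrict_holds
        𝒟.timeOrientation.contMDiff_restrict_holds U) (range (𝒟.embedOpens U h.embed_mem))) :
    (𝒟.restrict U hU h.embed_mem hν hC).EmbedsInto 𝒟' := by
  obtain ⟨ψ, hψi, hψτ, hψι⟩ := h.exists_isIsometricImmersion
  exact CauchyDevelopment.embedsInto_of_isIsometricImmersion (𝒟.restrict U hU h.embed_mem hν hC) 𝒟'
    hψi hψτ hψι

/-- **Def. 2.4 verbatim, backward**: if the restricted data embedding `(U, g|_U, τ|_U, ι, ν)`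
(`DataEmbedding.restrict`) embeds into `𝒮'` and `ι(X)` is a Cauchy hypersurface of
`(U, g|_U, τ|_U)`, then `U` is a common development of `𝒟` and `𝒮'`.
[cite: Sbierski2016AHP, §2, Def. 2.4 (arXiv: Def. 4)] -/
theorem isCommonDevelopment_of_restrict_embedsInto {U : Opens 𝒟.carrier}
    (hU : IsConnected (U : Set 𝒟.carrier)) (hι : ∀ x, 𝒟.embed x ∈ U)
    (hν : ∀ x, MDifferentiableAt (𝓡 n) (𝓡 (n + 1)).tangent
      (fun x ↦ (TotalSpace.mk' (EuclideanSpace ℝ (Fin (n + 1))) (𝒟.embed x) (𝒟.normal x) :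
        TangentBundle (𝓡 (n + 1)) 𝒟.carrier)) x)
    (hC : (𝒟.metric.restrict PseudoRiemannianMetric.contMDiff_restrict_holds U).IsCauchyHypersurface
      (𝒟.timeOrientation.restrict PseudoRiemannianMetric.contMDiff_restrict_holds
        𝒟.timeOrientation.contMDiff_restrict_holds U) (Subtype.val ⁻¹' range 𝒟.embed))
    (h : (𝒟.toDataEmbedding.restrict U hU hι hν).EmbedsInto 𝒮') :
    𝒟.IsCommonDevelopment 𝒮' U := by
  obtain ⟨ψ, -, -, hψi, hψτ, hψι⟩ := h
  exact ⟨hι, hC, ψ, hψi, hψτ, hψι⟩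

/-- **The whole spacetime is a common development of `𝒟` and any extension of `𝒟`**: if `𝒟`
embeds into `𝒮'` (as data embeddings) then `⊤ = M` satisfies `IsCommonDevelopment` — the
embedding restricted along `Subtype.val : ⊤ → M` (identity differential). Sbierski 2016, §2
(an extension of `M` makes `M` itself a CGHD). [cite: Sbierski2016AHP, §2, Def. 2.3–2.4 (arXiv: Def. 3–4)] -/
theorem isCommonDevelopment_top_of_embedsInto (h : 𝒟.toDataEmbedding.EmbedsInto 𝒮') :
    𝒟.IsCommonDevelopment 𝒮' ⊤ := by
  obtain ⟨ψ, hψs, -, hψi, hψτ, hψι⟩ := h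
  have hψd : MDifferentiable (𝓡 (n + 1)) (𝓡 (n + 1)) ψ := hψs.mdifferentiable (by simp)
  refine ⟨fun x ↦ trivial, ?_, ψ ∘ Subtype.val, ⟨hψs.comp contMDiff_subtype_val, fun y ↦ ?_⟩,
    fun y ↦ ?_, funext fun x ↦ congrFun hψι x⟩
  · -- `ι(X)` is a Cauchy hypersurface of the open sub-spacetime `⊤`
    intro γ s hγ
    have hγM : 𝒟.metric.IsEndlessTimelikeCurve 𝒟.timeOrientation (Subtype.val ∘ γ) s := by
      refine ⟨hγ.1, (LorentzianMetric.isFutureTimelikeCurveOn_restrict_iff 𝒟.metric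
        𝒟.timeOrientation PseudoRiemannianMetric.contMDiff_restrict_holds
        𝒟.timeOrientation.contMDiff_restrict_holds ⊤).1 hγ.2.1, ⟨hγ.2.2.1.1, fun p hp ↦ ?_⟩,
        ⟨hγ.2.2.2.1, fun p hp ↦ ?_⟩⟩
      · exact hγ.2.2.1.2 ⟨p, trivial⟩ (hasFutureEndpoint_subtypeVal_comp_iff.1 hp)
      · exact hγ.2.2.2.2 ⟨p, trivial⟩ (hasPastEndpoint_subtypeVal_comp_iff.1 hp)
    exact 𝒟.isCauchyHypersurface _ _ hγM
  · -- isometry identity along `Subtype.val`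
    ext v w
    rw [pullbackBilin_apply, mfderiv_comp_subtypeVal (hψd _)]
    have h2 := congrArg (fun b ↦ b v w) (hψi.2 y.1)
    simp only [pullbackBilin_apply] at h2
    exact h2
  · -- time orientation
    change 𝒮'.timeOrientation.IsFutureDirected
      (mfderiv (𝓡 (n + 1)) (𝓡 (n + 1)) (ψ ∘ Subtype.val) y (𝒟.timeOrientation.vectorField y.1))
    rw [mfderiv_comp_subtypeVal (hψd _)]
    exact hψτ y.1

/-! ### The maximal common globally hyperbolic development (Sbierski 2016, Thm. 10) -/

variable (𝒟 𝒮')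

/-- **The maximal common globally hyperbolic development (MCGHD)** of the Cauchy development `𝒟`
and the data embedding `𝒮'`, as an open subset of the spacetime of `𝒟`: the union of all
common developments `U ⊆ M` (`IsCommonDevelopment`). Sbierski 2016, Thm. 10 and its proof
(*"`U := ⋃_{α ∈ A} U_α` is the MCGHD of `M` and `M'`"*). It is a common development as soon as
one exists (`isCommonDevelopment_mcghd`), and contains every common development (`le_mcghd`).
[cite: Sbierski2016AHP, §3.1, Thm. 10 (arXiv numbering)] -/
def mcghd : Opens 𝒟.carrier :=
  ⨆ U : {U : Opens 𝒟.carrier // 𝒟.IsCommonDevelopment 𝒮' U}, U.1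

/-- A point lies in the MCGHD iff it lies in some common development. [cite: Sbierski2016AHP, §3.1, Thm. 10 (arXiv numbering)] -/
theorem mem_mcghd_iff {p : 𝒟.carrier} :
    p ∈ 𝒟.mcghd 𝒮' ↔ ∃ U : Opens 𝒟.carrier, 𝒟.IsCommonDevelopment 𝒮' U ∧ p ∈ U := by
  rw [mcghd, Opens.mem_iSup]
  exact ⟨fun ⟨U, hU⟩ ↦ ⟨U.1, U.2, hU⟩, fun ⟨U, hU, hp⟩ ↦ ⟨⟨U, hU⟩, hp⟩⟩

variable {𝒟 𝒮'} in
/-- **Maximality**: every common development is contained in the MCGHD (*"That `U` is maximal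
follows directly from its definition"*). [cite: Sbierski2016AHP, §3.1, Thm. 10 (arXiv numbering)] -/
theorem le_mcghd {U : Opens 𝒟.carrier} (hU : 𝒟.IsCommonDevelopment 𝒮' U) : U ≤ 𝒟.mcghd 𝒮' :=
  le_iSup (fun U : {U : Opens 𝒟.carrier // 𝒟.IsCommonDevelopment 𝒮' U} ↦ U.1) ⟨U, hU⟩

open scoped Classical in
/-- **The glued map** `ψ(p) := ψ_α(p)` for `p ∈ U_α` (Sbierski 2016, proof of Thm. 10), as a map
on all of `M`: at a point of some common development, the value of a chosen admissible immersion
of a chosen common development through the point; junk elsewhere. Independent of the choices by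
Cor. 8 (`mcghdFun_eq`). [cite: Sbierski2016AHP, §3.1, proof of Thm. 10 (arXiv numbering)] -/
def mcghdFun : 𝒟.carrier → 𝒮'.carrier := fun p ↦
  if h : ∃ U : Opens 𝒟.carrier, 𝒟.IsCommonDevelopment 𝒮' U ∧ p ∈ U then
    h.choose_spec.1.exists_isIsometricImmersion.choose ⟨p, h.choose_spec.2⟩
  else Classical.arbitrary _

/-- **The glued map on the MCGHD**, `ψ : ⋃ U_α → M'` (Sbierski 2016, proof of Thm. 10).
[cite: Sbierski2016AHP, §3.1, proof of Thm. 10 (arXiv numbering)] -/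
def mcghdMap : 𝒟.mcghd 𝒮' → 𝒮'.carrier :=
  𝒟.mcghdFun 𝒮' ∘ Subtype.val

variable {𝒟 𝒮'}

/-- **Well-definedness of the glued map** (*"By Corollary 8 this is well-defined"*): on a common
development `U`, the glued map agrees with *every* admissible immersion `ψ : U → M'`
(`IsCommonDevelopment.apply_eq_apply`). [cite: Sbierski2016AHP, §3.1, proof of Thm. 10 with Cor. 8 (arXiv numbering)] -/
theorem mcghdFun_eq {U : Opens 𝒟.carrier} (hU : 𝒟.IsCommonDevelopment 𝒮' U) {ψ : U → 𝒮'.carrier}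
    (hψi : (𝒟.metric.restrict PseudoRiemannianMetric.contMDiff_restrict_holds U).IsIsometricImmersion
      𝒮'.metric.toPseudoRiemannianMetric ψ)
    (hψτ : (𝒟.timeOrientation.restrict PseudoRiemannianMetric.contMDiff_restrict_holds
      𝒟.timeOrientation.contMDiff_restrict_holds U).PreservesTimeOrientation ψ 𝒮'.timeOrientation)
    (hψι : ψ ∘ 𝒟.embedOpens U hU.embed_mem = 𝒮'.embed) {p : 𝒟.carrier} (hp : p ∈ U) :
    𝒟.mcghdFun 𝒮' p = ψ ⟨p, hp⟩ := by
  have h : ∃ U : Opens 𝒟.carrier, 𝒟.IsCommonDevelopment 𝒮' U ∧ p ∈ U := ⟨U, hU, hp⟩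
  unfold mcghdFun
  rw [dif_pos h]
  obtain ⟨hχi, hχτ, hχι⟩ := h.choose_spec.1.exists_isIsometricImmersion.choose_spec
  exact h.choose_spec.1.apply_eq_apply hU hχi hχτ hχι hψi hψτ hψι h.choose_spec.2 hp

/-- The glued map is smooth at every point of every common development (it agrees with a smooth
immersion on the open `U`; Mathlib's `contMDiffAt_subtype_iff`). [cite: Sbierski2016AHP, §3.1, proof of Thm. 10 (arXiv numbering)] -/
theorem contMDiffAt_mcghdFun {U : Opens 𝒟.carrier} (hU : 𝒟.IsCommonDevelopment 𝒮' U)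
    {p : 𝒟.carrier} (hp : p ∈ U) :
    ContMDiffAt (𝓡 (n + 1)) (𝓡 (n + 1)) ∞ (𝒟.mcghdFun 𝒮') p := by
  obtain ⟨ψ, hψi, hψτ, hψι⟩ := hU.exists_isIsometricImmersion
  have heq : (fun y : U ↦ 𝒟.mcghdFun 𝒮' y) = ψ := funext fun y ↦ 𝒟.mcghdFun_eq hU hψi hψτ hψι y.2
  have h : ContMDiffAt (𝓡 (n + 1)) (𝓡 (n + 1)) ∞ (fun y : U ↦ 𝒟.mcghdFun 𝒮' y) ⟨p, hp⟩ := by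
    rw [heq]
    exact hψi.1 ⟨p, hp⟩
  exact contMDiffAt_subtype_iff.mp h

/-- The differential of the glued map at a point of a common development `U` is that of any
admissible immersion of `U` (`mfderiv_comp_subtypeVal`). [cite: Sbierski2016AHP, §3.1, proof of Thm. 10 (arXiv numbering)] -/
theorem mfderiv_mcghdFun_eq {U : Opens 𝒟.carrier} (hU : 𝒟.IsCommonDevelopment 𝒮' U)
    {ψ : U → 𝒮'.carrier}
    (hψi : (𝒟.metric.restrict PseudoRiemannianMetric.contMDiff_restrict_holds U).IsIsometricImmersion
      𝒮'.metric.toPseudoRiemannianMetric ψ)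
    (hψτ : (𝒟.timeOrientation.restrict PseudoRiemannianMetric.contMDiff_restrict_holds
      𝒟.timeOrientation.contMDiff_restrict_holds U).PreservesTimeOrientation ψ 𝒮'.timeOrientation)
    (hψι : ψ ∘ 𝒟.embedOpens U hU.embed_mem = 𝒮'.embed) {p : 𝒟.carrier} (hp : p ∈ U) :
    mfderiv (𝓡 (n + 1)) (𝓡 (n + 1)) (𝒟.mcghdFun 𝒮') p =
      mfderiv (𝓡 (n + 1)) (𝓡 (n + 1)) ψ ⟨p, hp⟩ := by
  have heq : 𝒟.mcghdFun 𝒮' ∘ (Subtype.val : U → 𝒟.carrier) = ψ :=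
    funext fun y ↦ 𝒟.mcghdFun_eq hU hψi hψτ hψι y.2
  have hd : MDifferentiableAt (𝓡 (n + 1)) (𝓡 (n + 1)) (𝒟.mcghdFun 𝒮') p :=
    (𝒟.contMDiffAt_mcghdFun hU hp).mdifferentiableAt (by simp)
  have h := mfderiv_comp_subtypeVal (I' := 𝓡 (n + 1)) (I := 𝓡 (n + 1)) (W := U) (y := ⟨p, hp⟩) hd
  rw [heq] at h
  exact h.symm

/-- **Sbierski 2016, Theorem 10 (existence of the MCGHD), main clause: the union of all common
globally hyperbolic developments is a common globally hyperbolic development** — provided there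
is one (*"By Theorem 4 this set is non-empty"*: local existence and uniqueness for the Einstein
equations, the hypothesis `hne`). Bullets of the printed proof: `ι(X) ⊆ U`; `ι(X)` is a Cauchy
hypersurface of the union (`LorentzianMetric.IsCauchyHypersurface.iSup_opens`); the glued map
`ψ(p) := ψ_α(p)` (`mcghdMap`, well defined by Cor. 8, `mcghdFun_eq`) is smooth, an isometric
immersion and time-orientation preserving — local properties read off on the `U_α` through the
point (`contMDiffAt_mcghdFun`, `mfderiv_mcghdFun_eq`) — and satisfies `ψ ∘ ι = ι'`.
[cite: Sbierski2016AHP, §3.1, Thm. 10 (arXiv numbering), proof p. 12] -/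
theorem isCommonDevelopment_mcghd (hne : ∃ U : Opens 𝒟.carrier, 𝒟.IsCommonDevelopment 𝒮' U) :
    𝒟.IsCommonDevelopment 𝒮' (𝒟.mcghd 𝒮') := by
  obtain ⟨U₀, hU₀⟩ := hne
  obtain ⟨ψ₀, hψ₀i, hψ₀τ, hψ₀ι⟩ := hU₀.exists_isIsometricImmersion
  have hmem : ∀ x, 𝒟.embed x ∈ 𝒟.mcghd 𝒮' := fun x ↦ 𝒟.le_mcghd hU₀ (hU₀.embed_mem x)
  -- the differential of the glued map at a point of the union
  have hdiff : ∀ p : 𝒟.mcghd 𝒮', ContMDiffAt (𝓡 (n + 1)) (𝓡 (n + 1)) ∞ (𝒟.mcghdFun 𝒮') p.1 :=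
    fun p ↦ by
      obtain ⟨U, hU, hp⟩ := (𝒟.mem_mcghd_iff 𝒮').1 p.2
      exact 𝒟.contMDiffAt_mcghdFun hU hp
  have hmf : ∀ p : 𝒟.mcghd 𝒮', mfderiv (𝓡 (n + 1)) (𝓡 (n + 1)) (𝒟.mcghdMap 𝒮') p =
      mfderiv (𝓡 (n + 1)) (𝓡 (n + 1)) (𝒟.mcghdFun 𝒮') p.1 := fun p ↦
    mfderiv_comp_subtypeVal ((hdiff p).mdifferentiableAt (by simp))
  refine ⟨hmem, ?_, 𝒟.mcghdMap 𝒮', ⟨fun p ↦ ?_, fun p ↦ ?_⟩, fun p ↦ ?_, funext fun x ↦ ?_⟩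
  · -- `ι(X)` is a Cauchy hypersurface of the union
    exact LorentzianMetric.IsCauchyHypersurface.iSup_opens PseudoRiemannianMetric.contMDiff_restrict_holds
      𝒟.timeOrientation.contMDiff_restrict_holds (WithTop.coe_le_coe.mpr le_top)
      𝒟.isCauchyHypersurface (fun U : {U : Opens 𝒟.carrier // 𝒟.IsCommonDevelopment 𝒮' U} ↦ U.1)
      fun U ↦ U.2.isCauchyHypersurface
  · -- smoothness of the glued map
    exact contMDiffAt_subtype_iff.mpr (hdiff p)
  · -- the isometry identity
    obtain ⟨U, hU, hp⟩ := (𝒟.mem_mcghd_iff 𝒮').1 p.2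
    obtain ⟨ψ, hψi, hψτ, hψι⟩ := hU.exists_isIsometricImmersion
    have h3 : 𝒟.mcghdMap 𝒮' p = ψ ⟨p.1, hp⟩ := 𝒟.mcghdFun_eq hU hψi hψτ hψι hp
    ext v w
    rw [pullbackBilin_apply, hmf p, 𝒟.mfderiv_mcghdFun_eq hU hψi hψτ hψι hp, h3]
    have h4 := congrArg (fun b ↦ b v w) (hψi.2 ⟨p.1, hp⟩)
    simp only [pullbackBilin_apply] at h4
    exact h4
  · -- time orientation
    obtain ⟨U, hU, hp⟩ := (𝒟.mem_mcghd_iff 𝒮').1 p.2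
    obtain ⟨ψ, hψi, hψτ, hψι⟩ := hU.exists_isIsometricImmersion
    have h3 : 𝒟.mcghdMap 𝒮' p = ψ ⟨p.1, hp⟩ := 𝒟.mcghdFun_eq hU hψi hψτ hψι hp
    change 𝒮'.timeOrientation.IsFutureDirected
      (mfderiv (𝓡 (n + 1)) (𝓡 (n + 1)) (𝒟.mcghdMap 𝒮') p (𝒟.timeOrientation.vectorField p.1))
    rw [hmf p, 𝒟.mfderiv_mcghdFun_eq hU hψi hψτ hψι hp,
      TimeOrientation.isFutureDirected_congr_point _ h3]
    exact hψτ ⟨p.1, hp⟩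
  · -- `ψ ∘ ι = ι'`
    change 𝒟.mcghdFun 𝒮' (𝒟.embed x) = 𝒮'.embed x
    rw [𝒟.mcghdFun_eq hU₀ hψ₀i hψ₀τ hψ₀ι (hU₀.embed_mem x)]
    exact congrFun hψ₀ι x

/-- **Sbierski 2016, Theorem 10 (existence of the MCGHD)**: *"Given two GHDs `M` and `M'` of the
same initial data, there exists a unique CGHD `U` of `M` and `M'` with the property that if `V` is
another CGHD of `M` and `M'`, then `U` is an extension of `V`"* — existence, over the common
developments realised as open subsets `U ⊆ M` (extension of `V` by `U` = `V ≤ U`), given that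
some common development exists (Thm. 4, local theory, hypothesis `hne`). The witness is the
union of all common developments (`mcghd`, `isCommonDevelopment_mcghd`, `le_mcghd`); uniqueness
is `IsCommonDevelopment.eq_mcghd_of_maximal`. [cite: Sbierski2016AHP, §3.1, Thm. 10 (arXiv numbering)] -/
theorem exists_isCommonDevelopment_maximal
    (hne : ∃ U : Opens 𝒟.carrier, 𝒟.IsCommonDevelopment 𝒮' U) :
    ∃ U : Opens 𝒟.carrier, 𝒟.IsCommonDevelopment 𝒮' U ∧
      ∀ V : Opens 𝒟.carrier, 𝒟.IsCommonDevelopment 𝒮' V → V ≤ U :=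
  ⟨𝒟.mcghd 𝒮', 𝒟.isCommonDevelopment_mcghd hne, fun _ hV ↦ 𝒟.le_mcghd hV⟩

/-- **Uniqueness clause of Sbierski's Theorem 10**: a common development containing every common
development is the MCGHD (*"It then also follows that `U` is the unique CGHD with this maximality
property"*). [cite: Sbierski2016AHP, §3.1, Thm. 10 (arXiv numbering)] -/
theorem IsCommonDevelopment.eq_mcghd_of_maximal {U : Opens 𝒟.carrier}
    (hU : 𝒟.IsCommonDevelopment 𝒮' U)
    (hmax : ∀ V : Opens 𝒟.carrier, 𝒟.IsCommonDevelopment 𝒮' V → V ≤ U) : U = 𝒟.mcghd 𝒮' :=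
  le_antisymm (𝒟.le_mcghd hU) (hmax _ (𝒟.isCommonDevelopment_mcghd ⟨U, hU⟩))

/-- If `𝒟` embeds into `𝒮'`, the MCGHD of `𝒟` and `𝒮'` is the whole spacetime of `𝒟`
(`isCommonDevelopment_top_of_embedsInto`, `le_mcghd`). Sbierski 2016, §2 (if `M'` extends `M`,
the MCGHD is `M`). [cite: Sbierski2016AHP, §3.1, Thm. 10 (arXiv numbering)] -/
theorem mcghd_eq_top_of_embedsInto (h : 𝒟.toDataEmbedding.EmbedsInto 𝒮') : 𝒟.mcghd 𝒮' = ⊤ :=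
  top_le_iff.mp (𝒟.le_mcghd (𝒟.isCommonDevelopment_top_of_embedsInto h))

end CauchyDevelopment

end Developments

end Literature.Geometry.Lorentzian

end
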